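import Summits.ResolutionOfSingularities.ResolutionOfSingularities.Theorems.EquisingularLiftEquisingularLiftNatDSeriesCharts
import HarnessLib

/-!
# [OURS] THE ODD `D`-SERIES: `D₃ = A₃ = y₀²y₁ + y₁² + y₂²` HAS BLOW-UP DEPTH `1` AND `D_{2m+5} = y₀²y₁ + y₁^{2m+4} + y₂²` HAS DEPTH `m + 2` IN EVERY
# BLOW-UP TOWER — every field of characteristic `≠ 2`, exact trinomial arithmetic
# (cruxes `Theses.EquisingularLift.EquisingularLiftNat` / `…NatThree` / `EquisingularLift`, stmt-ResolutionOfSingularities-20038 / -20148 / -15660)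

[OURS · leafhand-res-equisingularlift-12 g1, 2026-09-01; cell `pub/decomp-res`] AI-produced, weaker than expert review; NOT a statement of any manuscript;
nothing here proves resolution of singularities in positive characteristic.  DEF-FREE helper; no `sorry`; standard axioms; ZERO named hypotheses.

Companion of ✓ `…NatDEvenTower`.  With `x := y₂`, `y := y₀`, `z := y₁` the odd normal forms `x² + y²z + z^{2m+4}` (`D_{2m+5}`) descend LITERALLY in chart `1`:
`h_m(T₁T₀, T₁, T₁T₂) = T₁²·h_{m-1}(T)` and `h_0(T₁T₀, T₁, T₁T₂) = T₁²·(T₀²T₁ + T₁² + T₂²)`, the `A₃` normal form with tangent cone `T₁² + T₂²` (this is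
where `2 ≠ 0` is needed: in characteristic `2` that cone is a double plane); chart `0` carries a node with tail, chart `2` is empty.

* `SecondOrderPoint.A₃'_*` — the quadric `T₀T₁ + T₁² + T₂²` is first-order in every characteristic; charts of `A₃' = y₀²y₁ + y₁² + y₂²`; charts `1`, `2` are
  regular along the exceptional divisor when `2 ≠ 0`;
* ★★ `OneStep.towerLevel_origin_A₃'` — `y₀²y₁ + y₁² + y₂²` (`A₃ = D₃`) has `D`-level `1` (`2 ≠ 0` in `K`);
* ★★★ `OneStep.towerLevel_origin_D_odd` — by induction on `m`: `y₀²y₁ + y₁^{2m+4} + y₂²` (`D_{2m+5}`) has `D`-level `m + 2` (`2 ≠ 0` in `K`).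

Honest label: local level statements only (no vertex corollaries, see ✓ `…NatDEvenTower`); closes no registered stub.

References: [Hartshorne1977, I Thm. 5.1, I Ex. 5.6, II Ex. 7.12]; [Lipman1969, §24]; [StacksProject, Tags 0804, 080E]; through the cited tree files.
-/

set_option linter.dupNamespace false -- mandated namespace `Summit.<Summit>.<Problem>` of this single-conjunct summit

noncomputable section

open CategoryTheory CategoryTheory.Limits AlgebraicGeometry TopologicalSpace Topology
open MvPolynomial
open Literature.AlgebraicGeometry.Resolution
open AlgebraicGeometry.Scheme.IdealSheafData

namespace Summit.ResolutionOfSingularities.ResolutionOfSingularities.Cruxes.EquisingularLiftNat.Sections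

namespace SecondOrderPoint

variable (K : Type) [Field K]

/-! ## The quadric `T₀T₁ + T₁² + T₂²` and the `A₃` normal form `y₀²y₁ + y₁² + y₂²` -/

/-- `C 2 * q = q + q`. [folklore] -/
theorem C_two_mul (q : MvPolynomial (Fin 3) K) : C (2 : K) * q = q + q := by
  rw [map_ofNat]; ring

/-- The quadric `T₀T₁ + T₁² + T₂²` is a non-zero quadratic form. [folklore] -/
theorem A₃'_quadric_cone :
    (X 0 * X 1 + X 1 ^ 2 + X 2 ^ 2 : MvPolynomial (Fin 3) K).IsHomogeneous 2 ∧ (X 0 * X 1 + X 1 ^ 2 + X 2 ^ 2 : MvPolynomial (Fin 3) K) ≠ 0 := by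
  refine ⟨?_, fun h => ?_⟩
  · refine (IsHomogeneous.add ?_ (isHomogeneous_X_pow (1 : Fin 3) 2)).add (isHomogeneous_X_pow (2 : Fin 3) 2)
    simpa using (isHomogeneous_X K (0 : Fin 3)).mul (isHomogeneous_X K (1 : Fin 3))
  · have h1 := congrArg (eval (Pi.single (2 : Fin 3) (1 : K))) h
    simp at h1

/-- **The quadric `T₀T₁ + T₁² + T₂²` is first-order in EVERY characteristic**: a prime containing it and `∂₀ = T₁`, `∂₁ = T₀ + 2T₁` contains all `T_i`.
[cite: Hartshorne1977, I Thm. 5.1] -/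
theorem A₃'_quadric_firstOrder (Ψ₁ : MvPolynomial (Fin 3) K) (P : Ideal (MvPolynomial (Fin 3) K)) (hP : P.IsPrime)
    (hΦ : (X 0 * X 1 + X 1 ^ 2 + X 2 ^ 2 : MvPolynomial (Fin 3) K) ∈ P) (hd : ∀ i, pderiv i (X 0 * X 1 + X 1 ^ 2 + X 2 ^ 2 : MvPolynomial (Fin 3) K) ∈ P)
    (_hΨ : Ψ₁ ∈ P) (i : Fin 3) : (X i : MvPolynomial (Fin 3) K) ∈ P := by
  have hX1 : (X 1 : MvPolynomial (Fin 3) K) ∈ P := by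
    have h := hd 0
    rw [map_add, map_add, pderiv_mul, pderiv_X_self, pderiv_X_of_ne (by decide : (1 : Fin 3) ≠ 0), pderiv_pow,
      pderiv_X_of_ne (by decide : (1 : Fin 3) ≠ 0), pderiv_pow, pderiv_X_of_ne (by decide : (2 : Fin 3) ≠ 0)] at h
    have e : (X 1 : MvPolynomial (Fin 3) K) = 1 * X 1 + X 0 * 0 + ↑2 * X 1 ^ (2 - 1) * 0 + ↑2 * X 2 ^ (2 - 1) * 0 := by ring
    rw [e]; exact h
  have hX0 : (X 0 : MvPolynomial (Fin 3) K) ∈ P := by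
    have h := hd 1
    rw [map_add, map_add, pderiv_mul, pderiv_X_of_ne (by decide : (0 : Fin 3) ≠ 1), pderiv_X_self, pderiv_pow, pderiv_X_self, pderiv_pow,
      pderiv_X_of_ne (by decide : (2 : Fin 3) ≠ 1)] at h
    have e : (X 0 : MvPolynomial (Fin 3) K) = (0 * X 1 + X 0 * 1 + ↑2 * X 1 ^ (2 - 1) * 1 + ↑2 * X 2 ^ (2 - 1) * 0) - ↑2 * X 1 := by
      ring
    rw [e]; exact P.sub_mem h (P.mul_mem_left _ hX1)
  have hX2 : (X 2 : MvPolynomial (Fin 3) K) ∈ P := by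
    refine hP.mem_of_pow_mem 2 ?_
    have e : (X 2 ^ 2 : MvPolynomial (Fin 3) K) = (X 0 * X 1 + X 1 ^ 2 + X 2 ^ 2) - (X 0 + X 1) * X 1 := by ring
    rw [e]; exact P.sub_mem hΦ (P.mul_mem_left _ hX1)
  fin_cases i
  · simpa using hX0
  · simpa using hX1
  · simpa using hX2

/-- **Chart `0` of `A₃' = (y₁² + y₂²) + y₀²y₁`**: `T₀²·(T₀T₁ + T₁² + T₂²)`. [cite: Hartshorne1977, II Ex. 7.12] -/
theorem A₃'_strictTransform₀ :
    aeval (fun j => X 0 * Function.update (X : Fin 3 → MvPolynomial (Fin 3) K) 0 1 j)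
        ((X 1 ^ 2 + X 2 ^ 2) + X 0 ^ 2 * X 1 : MvPolynomial (Fin 3) K) = X 0 ^ 2 * (X 0 * X 1 + X 1 ^ 2 + X 2 ^ 2) := by
  simp only [map_add, map_mul, map_pow, aeval_X, Function.update_self, Function.update_of_ne (by decide : (1 : Fin 3) ≠ 0),
    Function.update_of_ne (by decide : (2 : Fin 3) ≠ 0)]
  ring

/-- **Chart `1` of `A₃'`**: `T₁²·(1 + T₂T₂ + T₀²T₁)`. [cite: Hartshorne1977, II Ex. 7.12] -/
theorem A₃'_strictTransform₁ :
    aeval (fun j => X 1 * Function.update (X : Fin 3 → MvPolynomial (Fin 3) K) 1 1 j)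
        ((X 1 ^ 2 + X 2 ^ 2) + X 0 ^ 2 * X 1 : MvPolynomial (Fin 3) K) = X 1 ^ 2 * (1 + X 2 * X 2 + X 0 ^ 2 * X 1) := by
  simp only [map_add, map_mul, map_pow, aeval_X, Function.update_self, Function.update_of_ne (by decide : (0 : Fin 3) ≠ 1),
    Function.update_of_ne (by decide : (2 : Fin 3) ≠ 1)]
  ring

/-- **Chart `2` of `A₃'`**: `T₂²·(1 + T₁T₁ + T₀²T₁T₂)`. [cite: Hartshorne1977, II Ex. 7.12] -/
theorem A₃'_strictTransform₂ :
    aeval (fun j => X 2 * Function.update (X : Fin 3 → MvPolynomial (Fin 3) K) 2 1 j)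
        ((X 1 ^ 2 + X 2 ^ 2) + X 0 ^ 2 * X 1 : MvPolynomial (Fin 3) K) = X 2 ^ 2 * (1 + X 1 * X 1 + X 0 ^ 2 * X 1 * X 2) := by
  simp only [map_add, map_mul, map_pow, aeval_X, Function.update_self, Function.update_of_ne (by decide : (0 : Fin 3) ≠ 2),
    Function.update_of_ne (by decide : (1 : Fin 3) ≠ 2)]
  ring

/-- **Chart `1` of `A₃'` is regular along `T₁ = 0`** (`2 ≠ 0`): `∂₂ = 2T₂ ∈ P` would put `T₂`, then `1 = G₁ - T₂² - T₀²T₁` in `P`. [cite: Hartshorne1977, I Thm. 5.1] -/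
theorem A₃'_chart₁_regular (h2 : (2 : K) ≠ 0) (P : Ideal (MvPolynomial (Fin 3) K)) (hP : P.IsPrime) (h1 : (X 1 : MvPolynomial (Fin 3) K) ∈ P)
    (hG : (1 + X 2 * X 2 + X 0 ^ 2 * X 1 : MvPolynomial (Fin 3) K) ∈ P) : pderiv 2 (1 + X 2 * X 2 + X 0 ^ 2 * X 1 : MvPolynomial (Fin 3) K) ∉ P := by
  intro hd
  rw [map_add, map_add, pderiv_one, pderiv_mul, pderiv_X_self, pderiv_mul, pderiv_pow, pderiv_X_of_ne (by decide : (0 : Fin 3) ≠ 2),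
    pderiv_X_of_ne (by decide : (1 : Fin 3) ≠ 2)] at hd
  have hX2 : (X 2 : MvPolynomial (Fin 3) K) ∈ P := by
    refine mem_of_C_mul_mem K h2 P hP ?_
    rw [C_two_mul]
    have e : (X 2 + X 2 : MvPolynomial (Fin 3) K) = 0 + (1 * X 2 + X 2 * 1) + (↑2 * X 0 ^ (2 - 1) * 0 * X 1 + X 0 ^ 2 * 0) := by ring
    rw [e]; exact hd
  have e : (1 : MvPolynomial (Fin 3) K) = (1 + X 2 * X 2 + X 0 ^ 2 * X 1) - (X 2 * X 2 + X 0 ^ 2 * X 1) := by ring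
  exact hP.ne_top ((Ideal.eq_top_iff_one P).mpr (e ▸ P.sub_mem hG (P.add_mem (P.mul_mem_left _ hX2) (P.mul_mem_left _ h1))))

/-- **Chart `2` of `A₃'` is regular along `T₂ = 0`** (`2 ≠ 0`): `∂₁ = 2T₁ + T₀²T₂`. [cite: Hartshorne1977, I Thm. 5.1] -/
theorem A₃'_chart₂_regular (h2 : (2 : K) ≠ 0) (P : Ideal (MvPolynomial (Fin 3) K)) (hP : P.IsPrime) (hX2 : (X 2 : MvPolynomial (Fin 3) K) ∈ P)
    (hG : (1 + X 1 * X 1 + X 0 ^ 2 * X 1 * X 2 : MvPolynomial (Fin 3) K) ∈ P) :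
    pderiv 1 (1 + X 1 * X 1 + X 0 ^ 2 * X 1 * X 2 : MvPolynomial (Fin 3) K) ∉ P := by
  intro hd
  rw [map_add, map_add, pderiv_one, pderiv_mul, pderiv_X_self, pderiv_mul, pderiv_mul, pderiv_pow, pderiv_X_of_ne (by decide : (0 : Fin 3) ≠ 1),
    pderiv_X_self, pderiv_X_of_ne (by decide : (2 : Fin 3) ≠ 1)] at hd
  have hX1 : (X 1 : MvPolynomial (Fin 3) K) ∈ P := by
    refine mem_of_C_mul_mem K h2 P hP ?_
    rw [C_two_mul]
    have e : (X 1 + X 1 : MvPolynomial (Fin 3) K) =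
        (0 + (1 * X 1 + X 1 * 1) + ((↑2 * X 0 ^ (2 - 1) * 0 * X 1 + X 0 ^ 2 * 1) * X 2 + X 0 ^ 2 * X 1 * 0)) - X 0 ^ 2 * X 2 := by ring
    rw [e]; exact P.sub_mem hd (P.mul_mem_left _ hX2)
  have e : (1 : MvPolynomial (Fin 3) K) = (1 + X 1 * X 1 + X 0 ^ 2 * X 1 * X 2) - X 1 * (X 1 + X 0 ^ 2 * X 2) := by ring
  exact hP.ne_top ((Ideal.eq_top_iff_one P).mpr (e ▸ P.sub_mem hG (P.mul_mem_right _ hX1)))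

/-- **Chart `0` of `A₃'`, mark analysis**: a prime containing `T₀`, `G₀ = T₀T₁ + T₁² + T₂²` and `∂₀G₀ = T₁` contains all `T_i`. [cite: Hartshorne1977, I Thm. 5.1] -/
theorem A₃'_jac₀ (P : Ideal (MvPolynomial (Fin 3) K)) (hP : P.IsPrime) (h0 : (X 0 : MvPolynomial (Fin 3) K) ∈ P)
    (hG : (X 0 * X 1 + X 1 ^ 2 + X 2 ^ 2 : MvPolynomial (Fin 3) K) ∈ P) (hd : ∀ j, pderiv j (X 0 * X 1 + X 1 ^ 2 + X 2 ^ 2 : MvPolynomial (Fin 3) K) ∈ P)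
    (i : Fin 3) : (X i - C ((0 : Fin 3 → K) i) : MvPolynomial (Fin 3) K) ∈ P := by
  have hX1 : (X 1 : MvPolynomial (Fin 3) K) ∈ P := by
    have h := hd 0
    rw [map_add, map_add, pderiv_mul, pderiv_X_self, pderiv_X_of_ne (by decide : (1 : Fin 3) ≠ 0), pderiv_pow,
      pderiv_X_of_ne (by decide : (1 : Fin 3) ≠ 0), pderiv_pow, pderiv_X_of_ne (by decide : (2 : Fin 3) ≠ 0)] at h
    have e : (X 1 : MvPolynomial (Fin 3) K) = 1 * X 1 + X 0 * 0 + ↑2 * X 1 ^ (2 - 1) * 0 + ↑2 * X 2 ^ (2 - 1) * 0 := by ring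
    rw [e]; exact h
  have hX2 : (X 2 : MvPolynomial (Fin 3) K) ∈ P := by
    refine hP.mem_of_pow_mem 2 ?_
    have e : (X 2 ^ 2 : MvPolynomial (Fin 3) K) = (X 0 * X 1 + X 1 ^ 2 + X 2 ^ 2) - (X 0 + X 1) * X 1 := by ring
    rw [e]; exact P.sub_mem hG (P.mul_mem_left _ hX1)
  exact forall_X_sub_C_zero_mem K P h0 hX1 hX2 i

/-! ## The odd `D`-series `h_m = y₀²y₁ + y₁^{2m+4} + y₂²` (`D_{2m+5}`): charts -/

/-- The tail `y₀²y₁ + y₁^{2m+4}` lies in `(y)³`. [folklore] -/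
theorem D_odd_tail_mem_pow (m : ℕ) :
    (X 0 ^ 2 * X 1 + X 1 ^ (2 * m + 4) : MvPolynomial (Fin 3) K) ∈ Ideal.span (Set.range (X : Fin 3 → MvPolynomial (Fin 3) K)) ^ (2 + 1) := by
  refine Ideal.add_mem _ ?_ ?_
  · simpa using monomial_mem_pow₃ K 2 1 0 (k := 2 + 1) (by norm_num)
  · simpa using monomial_mem_pow₃ K 0 (2 * m + 4) 0 (k := 2 + 1) (by omega)

/-- **Chart `0` of `h_m`**: `h_m(T₀, T₀T₁, T₀T₂) = T₀²·(T₀·(T₁ + T₀^{2m+1}T₁^{2m+4}) + T₂²)` — a node with tail. [cite: Hartshorne1977, II Ex. 7.12] -/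
theorem D_odd_strictTransform₀ (m : ℕ) :
    aeval (fun j => X 0 * Function.update (X : Fin 3 → MvPolynomial (Fin 3) K) 0 1 j)
        (X 2 ^ 2 + (X 0 ^ 2 * X 1 + X 1 ^ (2 * m + 4)) : MvPolynomial (Fin 3) K) =
      X 0 ^ 2 * (X 0 * (X 1 + X 0 ^ (2 * m + 1) * X 1 ^ (2 * m + 4)) + X 2 ^ 2) := by
  simp only [map_add, map_mul, map_pow, aeval_X, Function.update_self, Function.update_of_ne (by decide : (1 : Fin 3) ≠ 0),
    Function.update_of_ne (by decide : (2 : Fin 3) ≠ 0)]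
  ring

/-- **Chart `1` of `h_m`**: `h_m(T₁T₀, T₁, T₁T₂) = T₁²·(T₁·(T₀² + T₁^{2m+1}) + T₂²)` — which is `h_{m-1}` (`m ≥ 1`) or `A₃'` (`m = 0`).
[cite: Hartshorne1977, II Ex. 7.12] -/
theorem D_odd_strictTransform₁ (m : ℕ) :
    aeval (fun j => X 1 * Function.update (X : Fin 3 → MvPolynomial (Fin 3) K) 1 1 j)
        (X 2 ^ 2 + (X 0 ^ 2 * X 1 + X 1 ^ (2 * m + 4)) : MvPolynomial (Fin 3) K) =
      X 1 ^ 2 * (X 1 * (X 0 ^ 2 + X 1 ^ (2 * m + 1)) + X 2 ^ 2) := by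
  simp only [map_add, map_mul, map_pow, aeval_X, Function.update_self, Function.update_of_ne (by decide : (0 : Fin 3) ≠ 1),
    Function.update_of_ne (by decide : (2 : Fin 3) ≠ 1)]
  ring

/-- If `T_l` and `∂_l(T_l·A + T₂²)` lie in an ideal (`l ≠ 2`), so does `A`. [folklore] -/
theorem mem_of_pderiv_linear' {l : Fin 3} (hl2 : (2 : Fin 3) ≠ l) (A : MvPolynomial (Fin 3) K) (P : Ideal (MvPolynomial (Fin 3) K))
    (hl : (X l : MvPolynomial (Fin 3) K) ∈ P) (hd : pderiv l (X l * A + X 2 ^ 2 : MvPolynomial (Fin 3) K) ∈ P) : A ∈ P := by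
  rw [map_add, pderiv_mul, pderiv_X_self, pderiv_pow, pderiv_X_of_ne hl2] at hd
  have e : A = (1 * A + X l * pderiv l A + ↑2 * X 2 ^ (2 - 1) * 0) - X l * pderiv l A := by ring
  rw [e]
  exact P.sub_mem hd (P.mul_mem_right _ hl)

/-- If `T_l` and `T_l·A + T₂²` lie in a prime, so does `T₂`. [folklore] -/
theorem X_two_mem_of_linear' {l : Fin 3} (A : MvPolynomial (Fin 3) K) (P : Ideal (MvPolynomial (Fin 3) K)) (hP : P.IsPrime)
    (hl : (X l : MvPolynomial (Fin 3) K) ∈ P) (hG : (X l * A + X 2 ^ 2 : MvPolynomial (Fin 3) K) ∈ P) : (X 2 : MvPolynomial (Fin 3) K) ∈ P := by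
  refine hP.mem_of_pow_mem 2 ?_
  have e : (X 2 ^ 2 : MvPolynomial (Fin 3) K) = (X l * A + X 2 ^ 2) - X l * A := by ring
  rw [e]
  exact P.sub_mem hG (P.mul_mem_right _ hl)

end SecondOrderPoint

namespace OneStep

variable (K : Type) [Field K]

/-- ★★ **`A₃ = D₃`: `y₀²y₁ + y₁² + y₂²` HAS LEVEL `1` IN EVERY BLOW-UP TOWER** (`2 ≠ 0` in `K`): chart `0` carries the quadric `T₀T₁ + T₁² + T₂²` (one-step) at
its origin, charts `1`, `2` are regular along the exceptional divisor. [OURS] [cite: Hartshorne1977, I Thm. 5.1, I Ex. 5.6] [cite: StacksProject, Tags 0804, 080E] -/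
theorem towerLevel_origin_A₃' (h2 : (2 : K) ≠ 0) (D : ℕ → ∀ Γ : Scheme.{0}, Γ → Prop)
    (hD0 : ∀ (Γ : Scheme.{0}) (y : Γ), IsClosed (({y} : Set Γ)) →
      (D 0 Γ y ↔ ∀ (hy : IsClosed (({y} : Set Γ))) (Z : Scheme.{0}) (τ : Z ⟶ Γ), IsBlowup τ (vanishingIdeal ⟨{y}, hy⟩) →
        ∀ z : Z, τ z = y → IsRegularLocalRing (Z.presheaf.stalk z)))
    (hDsucc : ∀ (d : ℕ) (Γ : Scheme.{0}) (y : Γ), IsClosed (({y} : Set Γ)) →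
      (D (d + 1) Γ y ↔ ∀ (hy : IsClosed (({y} : Set Γ))) (Z : Scheme.{0}) (τ : Z ⟶ Γ), IsBlowup τ (vanishingIdeal ⟨{y}, hy⟩) →
        ∃ S' : Finset Z, (∀ z : Z, τ z = y → z ∉ S' → IsRegularLocalRing (Z.presheaf.stalk z)) ∧
          ∀ z ∈ S', τ z = y ∧ IsClosed (({z} : Set Z)) ∧ ∃ d' ≤ d, D d' Z z)) :
    ∀ (f : MvPolynomial (Fin 3) K), f = X 0 ^ 2 * X 1 + X 1 ^ 2 + X 2 ^ 2 →
      ∀ (y₀ : Spec (CommRingCat.of (MvPolynomial (Fin 3) K ⧸ Ideal.span {f}))),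
        y₀.asIdeal = Ideal.map (Ideal.Quotient.mk (Ideal.span {f})) (Ideal.span (Set.range (X : Fin 3 → MvPolynomial (Fin 3) K))) →
        D 1 (Spec (CommRingCat.of (MvPolynomial (Fin 3) K ⧸ Ideal.span {f}))) y₀ := by
  classical
  intro f hf y₀ hy₀
  have e : ((X 1 ^ 2 + X 2 ^ 2) : MvPolynomial (Fin 3) K) + X 0 ^ 2 * X 1 = f := by rw [hf]; ring
  subst e
  have hΦ : (X 1 ^ 2 + X 2 ^ 2 : MvPolynomial (Fin 3) K).IsHomogeneous 2 := (isHomogeneous_X_pow (1 : Fin 3) 2).add (isHomogeneous_X_pow (2 : Fin 3) 2)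
  have hΦ0 : (X 1 ^ 2 + X 2 ^ 2 : MvPolynomial (Fin 3) K) ≠ 0 := by
    intro h
    have h1 := congrArg (eval (Pi.single (2 : Fin 3) (1 : K))) h
    simp at h1
  have hΨ : (X 0 ^ 2 * X 1 : MvPolynomial (Fin 3) K) ∈ Ideal.span (Set.range (X : Fin 3 → MvPolynomial (Fin 3) K)) ^ (2 + 1) := by
    simpa using SecondOrderPoint.monomial_mem_pow₃ K 2 1 0 (k := 2 + 1) (by norm_num)
  have hG₀ := SecondOrderPoint.A₃'_strictTransform₀ K
  have hG₁ := SecondOrderPoint.A₃'_strictTransform₁ K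
  have hG₂ := SecondOrderPoint.A₃'_strictTransform₂ K
  have hq := SecondOrderPoint.A₃'_quadric_cone K
  have hΨ' : (0 + 0 : MvPolynomial (Fin 3) K) ∈ Ideal.span (Set.range (X : Fin 3 → MvPolynomial (Fin 3) K)) ^ (2 + 1) :=
    FirstOrderPoint.add_mem_pow_succ K (isHomogeneous_zero _ _ _) (Ideal.zero_mem _)
  have htr₀ : aeval (fun i : Fin 3 => X i + C ((0 : Fin 3 → K) i)) (X 0 * X 1 + X 1 ^ 2 + X 2 ^ 2 : MvPolynomial (Fin 3) K) =
      (X 0 * X 1 + X 1 ^ 2 + X 2 ^ 2) + (0 + 0) := by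
    rw [SecondOrderPoint.aeval_translate_zero]; ring
  refine towerLevel_succ_origin_marked K D hD0 hDsucc 0 (X 1 ^ 2 + X 2 ^ 2) (X 0 ^ 2 * X 1) (by norm_num) hΦ hΦ0 hΨ
    ![X 0 * X 1 + X 1 ^ 2 + X 2 ^ 2, 1 + X 2 * X 2 + X 0 ^ 2 * X 1, 1 + X 1 * X 1 + X 0 ^ 2 * X 1 * X 2] (fun a => ?_)
    ![{(0 : Fin 3 → K)}, ∅, ∅] (fun a P hP haP hGP => ?_) (fun a lam hlam _ => ?_) y₀ hy₀
  · fin_cases a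
    · exact hG₀
    · exact hG₁
    · exact hG₂
  · fin_cases a
    · by_cases hall : ∀ j, pderiv j (X 0 * X 1 + X 1 ^ 2 + X 2 ^ 2 : MvPolynomial (Fin 3) K) ∈ P
      · right
        refine ⟨0, ?_, ?_⟩
        · exact Finset.mem_singleton_self _
        · exact SecondOrderPoint.A₃'_jac₀ K P hP haP hGP hall
      · left
        push Not at hall
        exact hall
    · exact Or.inl ⟨2, SecondOrderPoint.A₃'_chart₁_regular K h2 P hP haP hGP⟩
    · exact Or.inl ⟨1, SecondOrderPoint.A₃'_chart₂_regular K h2 P hP haP hGP⟩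
  · fin_cases a
    · have hlam0 : lam = 0 := by simpa using hlam
      subst hlam0
      refine ⟨2, X 0 * X 1 + X 1 ^ 2 + X 2 ^ 2, 0 + 0, by norm_num, hq.1, hΨ', htr₀, fun y' hy' => ⟨0, le_rfl, ?_⟩⟩
      exact towerLevel_zero_origin K D hD0 hDsucc (X 0 * X 1 + X 1 ^ 2 + X 2 ^ 2) (0 + 0) (by norm_num) hq.1 hq.2 hΨ'
        (fun b => FirstOrderPoint.exists_strictTransform K (X 0 * X 1 + X 1 ^ 2 + X 2 ^ 2) 0 0 hq.1 (isHomogeneous_zero _ _ _) (Ideal.zero_mem _)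
          (fun P hP hΦP hdP hΨP => SecondOrderPoint.A₃'_quadric_firstOrder K 0 P hP hΦP hdP hΨP) b) y' hy'
    · exact absurd hlam (Finset.notMem_empty _)
    · exact absurd hlam (Finset.notMem_empty _)

/-- **THE ODD `D` STEP**: if the chart-`1` strict transform `T₁·(T₀² + T₁^{2m+1}) + T₂²` of `h_m = y₀²y₁ + y₁^{2m+4} + y₂²`, split as `Φ' + Ψ'`
(`Φ'` a quadratic form, `Ψ' ∈ (T)³`), has `D`-level `m + 1` at its origin, then the origin of `Spec K[y]/(h_m)` has `D`-level `m + 2`: chart `0` carries a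
node with tail (level `0`), chart `2` is empty — every field, every characteristic. [OURS] [cite: Hartshorne1977, I Thm. 5.1, I Ex. 5.6]
[cite: StacksProject, Tags 0804, 080E] -/
theorem towerLevel_origin_D_odd_step (D : ℕ → ∀ Γ : Scheme.{0}, Γ → Prop)
    (hD0 : ∀ (Γ : Scheme.{0}) (y : Γ), IsClosed (({y} : Set Γ)) →
      (D 0 Γ y ↔ ∀ (hy : IsClosed (({y} : Set Γ))) (Z : Scheme.{0}) (τ : Z ⟶ Γ), IsBlowup τ (vanishingIdeal ⟨{y}, hy⟩) →
        ∀ z : Z, τ z = y → IsRegularLocalRing (Z.presheaf.stalk z)))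
    (hDsucc : ∀ (d : ℕ) (Γ : Scheme.{0}) (y : Γ), IsClosed (({y} : Set Γ)) →
      (D (d + 1) Γ y ↔ ∀ (hy : IsClosed (({y} : Set Γ))) (Z : Scheme.{0}) (τ : Z ⟶ Γ), IsBlowup τ (vanishingIdeal ⟨{y}, hy⟩) →
        ∃ S' : Finset Z, (∀ z : Z, τ z = y → z ∉ S' → IsRegularLocalRing (Z.presheaf.stalk z)) ∧
          ∀ z ∈ S', τ z = y ∧ IsClosed (({z} : Set Z)) ∧ ∃ d' ≤ d, D d' Z z)) (m : ℕ) (Φ' Ψ' : MvPolynomial (Fin 3) K) (hΦ' : Φ'.IsHomogeneous 2)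
    (hΨ' : Ψ' ∈ Ideal.span (Set.range (X : Fin 3 → MvPolynomial (Fin 3) K)) ^ (2 + 1))
    (he : (X 1 * (X 0 ^ 2 + X 1 ^ (2 * m + 1)) + X 2 ^ 2 : MvPolynomial (Fin 3) K) = Φ' + Ψ')
    (hlev : ∀ (y' : Spec (CommRingCat.of (MvPolynomial (Fin 3) K ⧸ Ideal.span {Φ' + Ψ'}))),
      y'.asIdeal = Ideal.map (Ideal.Quotient.mk (Ideal.span {Φ' + Ψ'})) (Ideal.span (Set.range (X : Fin 3 → MvPolynomial (Fin 3) K))) →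
      D (m + 1) (Spec (CommRingCat.of (MvPolynomial (Fin 3) K ⧸ Ideal.span {Φ' + Ψ'}))) y') :
    ∀ (y₀ : Spec (CommRingCat.of (MvPolynomial (Fin 3) K ⧸ Ideal.span {(X 2 ^ 2 : MvPolynomial (Fin 3) K) + (X 0 ^ 2 * X 1 + X 1 ^ (2 * m + 4))}))),
      y₀.asIdeal = Ideal.map (Ideal.Quotient.mk (Ideal.span {(X 2 ^ 2 : MvPolynomial (Fin 3) K) + (X 0 ^ 2 * X 1 + X 1 ^ (2 * m + 4))}))
        (Ideal.span (Set.range (X : Fin 3 → MvPolynomial (Fin 3) K))) →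
      D (m + 2) (Spec (CommRingCat.of (MvPolynomial (Fin 3) K ⧸ Ideal.span {(X 2 ^ 2 : MvPolynomial (Fin 3) K) + (X 0 ^ 2 * X 1 + X 1 ^ (2 * m + 4))}))) y₀ := by
  classical
  intro y₀ hy₀
  have hΦ : (X 2 ^ 2 : MvPolynomial (Fin 3) K).IsHomogeneous 2 := isHomogeneous_X_pow (2 : Fin 3) 2
  have hΦ0 : (X 2 ^ 2 : MvPolynomial (Fin 3) K) ≠ 0 := pow_ne_zero _ (X_ne_zero 2)
  have hnode := SecondOrderPoint.node_cone_C K 1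
  have hΨ := SecondOrderPoint.D_odd_tail_mem_pow K m
  obtain ⟨G₂, hG₂, hJ₂⟩ := SecondOrderPoint.sq_chart_vacuous₂ K hΨ
  have hG₀ := SecondOrderPoint.D_odd_strictTransform₀ K m
  have hG₁ := SecondOrderPoint.D_odd_strictTransform₁ K m
  have htail₀' : (X 0 ^ (2 * m + 2) * X 1 ^ (2 * m + 4) : MvPolynomial (Fin 3) K) ∈
      Ideal.span (Set.range (X : Fin 3 → MvPolynomial (Fin 3) K)) ^ 4 := by
    simpa using SecondOrderPoint.monomial_mem_pow₃ K (2 * m + 2) (2 * m + 4) 0 (k := 4) (by omega)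
  have htail₀ : (0 + X 0 ^ (2 * m + 2) * X 1 ^ (2 * m + 4) : MvPolynomial (Fin 3) K) ∈
      Ideal.span (Set.range (X : Fin 3 → MvPolynomial (Fin 3) K)) ^ (2 + 1) :=
    FirstOrderPoint.add_mem_pow_succ K (isHomogeneous_zero _ _ _) htail₀'
  have htr₀ : aeval (fun i : Fin 3 => X i + C ((0 : Fin 3 → K) i)) (X 0 * (X 1 + X 0 ^ (2 * m + 1) * X 1 ^ (2 * m + 4)) + X 2 ^ 2 : MvPolynomial (Fin 3) K) =
      (C (1 : K) * (X 0 * X 1) + X 2 ^ 2) + (0 + X 0 ^ (2 * m + 2) * X 1 ^ (2 * m + 4)) := by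
    rw [SecondOrderPoint.aeval_translate_zero, map_one]; ring
  have htr₁ : aeval (fun i : Fin 3 => X i + C ((0 : Fin 3 → K) i)) (X 1 * (X 0 ^ 2 + X 1 ^ (2 * m + 1)) + X 2 ^ 2 : MvPolynomial (Fin 3) K) =
      Φ' + Ψ' := by
    rw [SecondOrderPoint.aeval_translate_zero]; exact he
  refine towerLevel_succ_origin_marked K D hD0 hDsucc (m + 1) (X 2 ^ 2) (X 0 ^ 2 * X 1 + X 1 ^ (2 * m + 4)) (by norm_num) hΦ hΦ0 hΨ
    ![X 0 * (X 1 + X 0 ^ (2 * m + 1) * X 1 ^ (2 * m + 4)) + X 2 ^ 2, X 1 * (X 0 ^ 2 + X 1 ^ (2 * m + 1)) + X 2 ^ 2, G₂] (fun a => ?_)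
    ![{(0 : Fin 3 → K)}, {(0 : Fin 3 → K)}, ∅] (fun a P hP haP hGP => ?_) (fun a lam hlam _ => ?_) y₀ hy₀
  · fin_cases a
    · exact hG₀
    · exact hG₁
    · exact hG₂
  · fin_cases a
    · by_cases hall : ∀ j, pderiv j (X 0 * (X 1 + X 0 ^ (2 * m + 1) * X 1 ^ (2 * m + 4)) + X 2 ^ 2 : MvPolynomial (Fin 3) K) ∈ P
      · right
        have hX2 := SecondOrderPoint.X_two_mem_of_linear' K _ P hP haP hGP
        have hA := SecondOrderPoint.mem_of_pderiv_linear' K (l := 0) (by decide) _ P haP (hall 0)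
        have hX1 : (X 1 : MvPolynomial (Fin 3) K) ∈ P := by
          have e : (X 1 : MvPolynomial (Fin 3) K) = (X 1 + X 0 ^ (2 * m + 1) * X 1 ^ (2 * m + 4)) - X 0 * (X 0 ^ (2 * m) * X 1 ^ (2 * m + 4)) := by
            ring
          rw [e]; exact P.sub_mem hA (P.mul_mem_right _ haP)
        refine ⟨0, ?_, ?_⟩
        · exact Finset.mem_singleton_self _
        · exact SecondOrderPoint.forall_X_sub_C_zero_mem K P haP hX1 hX2
      · left
        push Not at hall
        exact hall
    · by_cases hall : ∀ j, pderiv j (X 1 * (X 0 ^ 2 + X 1 ^ (2 * m + 1)) + X 2 ^ 2 : MvPolynomial (Fin 3) K) ∈ P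
      · right
        have hX2 := SecondOrderPoint.X_two_mem_of_linear' K _ P hP haP hGP
        have hA := SecondOrderPoint.mem_of_pderiv_linear' K (l := 1) (by decide) _ P haP (hall 1)
        have hX0 : (X 0 : MvPolynomial (Fin 3) K) ∈ P := by
          refine hP.mem_of_pow_mem 2 ?_
          have e : (X 0 ^ 2 : MvPolynomial (Fin 3) K) = (X 0 ^ 2 + X 1 ^ (2 * m + 1)) - X 1 * X 1 ^ (2 * m) := by ring
          rw [e]; exact P.sub_mem hA (P.mul_mem_right _ haP)
        refine ⟨0, ?_, ?_⟩
        · exact Finset.mem_singleton_self _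
        · exact SecondOrderPoint.forall_X_sub_C_zero_mem K P hX0 haP hX2
      · left
        push Not at hall
        exact hall
    · exact (hJ₂ P hP haP hGP).elim
  · fin_cases a
    · have hlam0 : lam = 0 := by simpa using hlam
      subst hlam0
      refine ⟨2, C (1 : K) * (X 0 * X 1) + X 2 ^ 2, 0 + X 0 ^ (2 * m + 2) * X 1 ^ (2 * m + 4), by norm_num, hnode.1, htail₀, htr₀,
        fun y' hy' => ⟨0, by omega, ?_⟩⟩
      exact towerLevel_zero_origin K D hD0 hDsucc _ _ (by norm_num) hnode.1 hnode.2 htail₀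
        (fun b => SecondOrderPoint.node_oneStep_C K one_ne_zero 0 _ (isHomogeneous_zero _ _ _) htail₀' b) y' hy'
    · have hlam0 : lam = 0 := by simpa using hlam
      subst hlam0
      exact ⟨2, Φ', Ψ', by norm_num, hΦ', hΨ', htr₁, fun y' hy' => ⟨m + 1, le_rfl, hlev y' hy'⟩⟩
    · exact absurd hlam (Finset.notMem_empty _)

/-- ★★★ **`D_{2m+5}` HAS LEVEL `m + 2` IN EVERY BLOW-UP TOWER** (`2 ≠ 0` in `K`): for every `m` and every `f = y₀²y₁ + y₁^{2m+4} + y₂²`, the origin of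
`Spec K[y]/(f)` has `D`-level `m + 2` (`D₅ → A₁ + A₃`, `D_{2m+5} → A₁ + D_{2m+3}` literally in chart `1`). [OURS] [cite: Hartshorne1977, I Thm. 5.1, I Ex. 5.6]
[cite: Lipman1969, §24] [cite: StacksProject, Tag 080E] -/
theorem towerLevel_origin_D_odd (h2 : (2 : K) ≠ 0) (D : ℕ → ∀ Γ : Scheme.{0}, Γ → Prop)
    (hD0 : ∀ (Γ : Scheme.{0}) (y : Γ), IsClosed (({y} : Set Γ)) →
      (D 0 Γ y ↔ ∀ (hy : IsClosed (({y} : Set Γ))) (Z : Scheme.{0}) (τ : Z ⟶ Γ), IsBlowup τ (vanishingIdeal ⟨{y}, hy⟩) →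
        ∀ z : Z, τ z = y → IsRegularLocalRing (Z.presheaf.stalk z)))
    (hDsucc : ∀ (d : ℕ) (Γ : Scheme.{0}) (y : Γ), IsClosed (({y} : Set Γ)) →
      (D (d + 1) Γ y ↔ ∀ (hy : IsClosed (({y} : Set Γ))) (Z : Scheme.{0}) (τ : Z ⟶ Γ), IsBlowup τ (vanishingIdeal ⟨{y}, hy⟩) →
        ∃ S' : Finset Z, (∀ z : Z, τ z = y → z ∉ S' → IsRegularLocalRing (Z.presheaf.stalk z)) ∧
          ∀ z ∈ S', τ z = y ∧ IsClosed (({z} : Set Z)) ∧ ∃ d' ≤ d, D d' Z z)) (m : ℕ) :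
    ∀ (f : MvPolynomial (Fin 3) K), f = X 0 ^ 2 * X 1 + X 1 ^ (2 * m + 4) + X 2 ^ 2 →
      ∀ (y₀ : Spec (CommRingCat.of (MvPolynomial (Fin 3) K ⧸ Ideal.span {f}))),
        y₀.asIdeal = Ideal.map (Ideal.Quotient.mk (Ideal.span {f})) (Ideal.span (Set.range (X : Fin 3 → MvPolynomial (Fin 3) K))) →
        D (m + 2) (Spec (CommRingCat.of (MvPolynomial (Fin 3) K ⧸ Ideal.span {f}))) y₀ := by
  induction m with
  | zero =>
    intro f hf y₀ hy₀
    have e : (X 2 ^ 2 : MvPolynomial (Fin 3) K) + (X 0 ^ 2 * X 1 + X 1 ^ (2 * 0 + 4)) = f := by rw [hf]; ring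
    subst e
    have hΦ' : (X 1 ^ 2 + X 2 ^ 2 : MvPolynomial (Fin 3) K).IsHomogeneous 2 := (isHomogeneous_X_pow (1 : Fin 3) 2).add (isHomogeneous_X_pow (2 : Fin 3) 2)
    have hΨ' : (X 0 ^ 2 * X 1 : MvPolynomial (Fin 3) K) ∈ Ideal.span (Set.range (X : Fin 3 → MvPolynomial (Fin 3) K)) ^ (2 + 1) := by
      simpa using SecondOrderPoint.monomial_mem_pow₃ K 2 1 0 (k := 2 + 1) (by norm_num)
    exact towerLevel_origin_D_odd_step K D hD0 hDsucc 0 (X 1 ^ 2 + X 2 ^ 2) (X 0 ^ 2 * X 1) hΦ' hΨ' (by ring)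
      (fun y' hy' => towerLevel_origin_A₃' K h2 D hD0 hDsucc _ (by ring) y' hy') y₀ hy₀
  | succ m ih =>
    intro f hf y₀ hy₀
    have e : (X 2 ^ 2 : MvPolynomial (Fin 3) K) + (X 0 ^ 2 * X 1 + X 1 ^ (2 * (m + 1) + 4)) = f := by rw [hf]; ring
    subst e
    have hΦ' : (X 2 ^ 2 : MvPolynomial (Fin 3) K).IsHomogeneous 2 := isHomogeneous_X_pow (2 : Fin 3) 2
    exact towerLevel_origin_D_odd_step K D hD0 hDsucc (m + 1) (X 2 ^ 2) (X 0 ^ 2 * X 1 + X 1 ^ (2 * m + 4)) hΦ'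
      (SecondOrderPoint.D_odd_tail_mem_pow K m) (by ring) (fun y' hy' => ih _ (by ring) y' hy') y₀ hy₀

end OneStep

end Summit.ResolutionOfSingularities.ResolutionOfSingularities.Cruxes.EquisingularLiftNat.Sections

end
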